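import Summits.Ventures.CertifiedQuantumChemistry.Rows.StrongCouplingScaledGapBound
import Literature.MathematicalPhysics.QuantumLattice.HubbardModelThermodynamicLimitProofs
import HarnessLib

/-!
# Ventures/CertifiedQuantumChemistry — Rows/StrongCouplingDegreeBound.lean: THE EXTENSIVE CONSTANT —
# with a ROW-SUM bound `Σ_q ‖h_pq‖ ≤ ρ` on the hopping table the doublon budget is `(4ρ√|Λ|/U)²`
# (linear in `|Λ|`); on the TV-H ring `ρ = 2|t|`: `s ≤ 64t²L/U²`, `E_PQG ≥ −16t²L/U`, and the
# conjecture leaf's scaled gap obeys `0 ≤ ĉ_X(2n;U) ≤ 8n` — at most `4` per site, uniformly in `U`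

HONEST FRAMING (verbatim): certified bounds for a stated model Hamiltonian in a stated basis; not a
claim about the real molecule beyond that model. Nothing here is a state, a row, a claim node or a
value of record; the statements are a-priori bounds about ARBITRARY (resp. optimal) feasible pairs and
the optimal values of the two-positivity relaxations of Hubbard-type tables and of the cell's
test-vector models `hubbardRingTV L t U`, and about the scaled gap of the conjecture leaf
`Rows/ConjectureSU2.lean`, whose clauses are UNTOUCHED (a bounded function need not converge; the
per-site bound `4` is an a-priori ceiling, not a value).

Seat rdm-B (gen 36), zero compute; theorems only (no `def`). The gen-35/36 step-(1) files
(`Rows/StrongCouplingDoublonBound`, `…BudgetBounds`, `…ScaledGapBound`) charge EVERY ordered pair of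
sites with the hop bound and get the crude constant `C = 4τ|Λ|√|Λ|` (budget `∝ |Λ|³`). The words of
CLAIM N / LEMMA S-1 use a BOND constant `K_L`. This file types the sharper bookkeeping: only the row
sums of `‖h‖` enter, `C_ρ = 4ρ√|Λ|` with `ρ ≥ max_p Σ_q ‖h_pq‖` (`2|t|` on a ring, `Δ·τ` on a graph
of maximal degree `Δ`), so the budget `Σ_p Re d_p ≤ 16ρ²|Λ|/U²` and the value floor
`E_PQG ≥ Re E_core − 4ρ²|Λ|/U` are EXTENSIVE — and the scaled gap of S-U is bounded by `4` PER SITE: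

* §1 `re_oneBody_ge_rowSum` — `Re Σ_{pq} h_pq Σ_σ γ_{pσ,qσ} ≥ −4ρ√|Λ|·√s` on every feasible pair of the
  half-filled sector programme (`h_pp = 0`, `Σ_q ‖h_pq‖ ≤ ρ`; the hop bound per ordered pair summed
  against the row, Cauchy–Schwarz over sites, `Σ e = Σ d`); `re_rdmEnergy_ge_rowSum`
  (`Re E ≥ Re E_core + U·s − 4ρ√|Λ|√s`); **`sum_doublon_le_sq_rowSum`** (`Re E ≤ Re E_core`, `U > 0` ⇒
  `s ≤ (4ρ√|Λ|/U)²`); **`sub_le_pqgSectorEnergy_rowSum`** (`Re E_core − (4ρ√|Λ|)²/(4U) ≤ E_PQG(a, b)`).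
* §2 the TV-H ring: `card_filter_ringAdj_le_two` (every site has at most two ring neighbours),
  `sum_norm_hubbardRingTV_h_le` (`Σ_q ‖h_pq‖ ≤ 2|t|`), **`hubbardRingTV_sum_doublon_le_linear`**
  (`s ≤ (8|t|√L/U)² = 64t²L/U²` for every feasible pair with `Re E ≤ 0` at half filling, `L ≥ 2`),
  `hubbardRingTV_optimal_sum_doublon_le_linear` (unconditionally at the optimum),
  **`hubbardRingTV_pqgSectorEnergy_ge_linear`** (`−16t²L/U ≤ E_PQG^sector`).
* §3 the conjecture leaf's scaled gap (`t = 1`, `L = 2n`, `n ≥ 1`, `U > 0`):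
  **`scaledGap_sector_le_linear`** / **`scaledGap_singlet_le_linear`** — `ĉ_X(2n;U) ≤ 8n` at both
  levels (with `0 ≤` from `Rows/StrongCouplingScaledGapBound`), and `scaledGap_…_limit_le_linear` —
  any limit `c` of the scaled gap along `U → ∞` has `c ≤ 8n`, i.e. `c/(2n) ≤ 4`: IF the constants of
  `ConjectureSU2_DQG` / `ConjectureSU2_DQGS2` exist, their per-site values are at most `4` (the leaf
  registers `c 2 = √2 − 1`, `c 3 ≈ 1.243`; nothing about existence or values is used or advanced here).

Everything is PROVED (0 sorry), standard axioms; no definitions, no named facts; no claim node, hint,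
row or CERTIFIED cell depends on it. References (docstring-only): as in the siblings; the ring-degree
count reuses the tree's `ThermodynamicLimit.eq_mod_of_succ_mod_eq`.
-/

noncomputable section

namespace Summit.Ventures.CertifiedQuantumChemistry

open Matrix Finset
open Literature.MathematicalPhysics.QuantumLattice Literature.MathematicalPhysics.QuantumChemistry
open scoped ComplexOrder

namespace StrongCouplingGap

/-! ### §1 Row-sum bookkeeping on a half-filled Hubbard-type table -/

section RowSum

variable {Λ : Type*} [LinearOrder Λ] [Fintype Λ] {a b : ℕ}
variable {γ : Matrix (Orb Λ) (Orb Λ) ℂ} {Γ : Matrix (Orb Λ × Orb Λ) (Orb Λ × Orb Λ) ℂ}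

/-- Per site: `Σ_q ‖h_pq‖ · Σ_σ ‖γ_{pσ,qσ}‖ ≤ 2ρ (√(Re d_p) + √(Re e_p))` for a feasible pair of the
half-filled sector programme (`|Λ| ≥ 2`), a table with `h_pp = 0` and row sums `Σ_q ‖h_pq‖ ≤ ρ`.
[folklore] -/
theorem sum_norm_mul_sum_norm_hop_le (hf : IsDQGFeasibleSector a b γ Γ) (hN : a + b = Fintype.card Λ)
    (hΛ : 2 ≤ Fintype.card Λ) {h : Λ → Λ → ℂ} {ρ : ℝ} (hrow : ∀ p, ∑ q, ‖h p q‖ ≤ ρ)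
    (hdiag : ∀ p, h p p = 0) (p : Λ) :
    ∑ q : Λ, ‖h p q‖ * ∑ σ : Fin 2, ‖γ (orb p σ) (orb q σ)‖ ≤
      2 * ρ * (Real.sqrt (Γ (orb p 0, orb p 1) (orb p 0, orb p 1)).re +
        Real.sqrt (qMap γ Γ (orb p 0, orb p 1) (orb p 0, orb p 1)).re) := by
  set R := Real.sqrt (Γ (orb p 0, orb p 1) (orb p 0, orb p 1)).re +
    Real.sqrt (qMap γ Γ (orb p 0, orb p 1) (orb p 0, orb p 1)).re with hR
  have hR0 : 0 ≤ R := add_nonneg (Real.sqrt_nonneg _) (Real.sqrt_nonneg _)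
  have hr : a + b + 2 ≤ Fintype.card (Orb Λ) := by rw [StrongCouplingDoublon.card_orb]; omega
  have hterm : ∀ q, ‖h p q‖ * ∑ σ : Fin 2, ‖γ (orb p σ) (orb q σ)‖ ≤ ‖h p q‖ * (2 * R) := by
    intro q
    by_cases hpq : p = q
    · subst hpq
      rw [hdiag, norm_zero, zero_mul, zero_mul]
    · exact mul_le_mul_of_nonneg_left (StrongCouplingDoublon.sum_norm_hop_le hf.dqg hr hpq)
        (norm_nonneg _)
  calc ∑ q : Λ, ‖h p q‖ * ∑ σ : Fin 2, ‖γ (orb p σ) (orb q σ)‖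
      ≤ ∑ q : Λ, ‖h p q‖ * (2 * R) := Finset.sum_le_sum fun q _ => hterm q
    _ = (∑ q : Λ, ‖h p q‖) * (2 * R) := by rw [Finset.sum_mul]
    _ ≤ ρ * (2 * R) := mul_le_mul_of_nonneg_right (hrow p) (by positivity)
    _ = 2 * ρ * R := by ring

/-- **THE ONE-BODY TERM WITH A ROW-SUM CONSTANT.** For a feasible pair of the half-filled sector
programme (`a + b = |Λ| ≥ 2`) and a table with `h_pp = 0`, `Σ_q ‖h_pq‖ ≤ ρ`:
`Re Σ_{pq} h_pq Σ_σ γ_{pσ,qσ} ≥ −4ρ√|Λ| · √s`, `s = Σ_p Re d_p` — `√|Λ|`, not `|Λ|√|Λ|`. [folklore] -/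
theorem re_oneBody_ge_rowSum (hf : IsDQGFeasibleSector a b γ Γ) (hN : a + b = Fintype.card Λ)
    (hΛ : 2 ≤ Fintype.card Λ) {h : Λ → Λ → ℂ} {ρ : ℝ} (hrow : ∀ p, ∑ q, ‖h p q‖ ≤ ρ)
    (hdiag : ∀ p, h p p = 0) :
    -(4 * ρ * Real.sqrt (Fintype.card Λ) *
        Real.sqrt (∑ p : Λ, (Γ (orb p 0, orb p 1) (orb p 0, orb p 1)).re))
      ≤ (∑ p : Λ, ∑ q : Λ, h p q * ∑ σ : Fin 2, γ (orb p σ) (orb q σ)).re := by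
  have hρ0 : 0 ≤ ρ := by
    obtain ⟨p⟩ : Nonempty Λ := Fintype.card_pos_iff.1 (by omega)
    exact le_trans (sum_nonneg fun q _ => norm_nonneg _) (hrow p)
  have hd0 : ∀ p : Λ, 0 ≤ (Γ (orb p 0, orb p 1) (orb p 0, orb p 1)).re := fun p =>
    (Complex.nonneg_iff.1 (hf.dqg.d_psd.diag_nonneg (i := (orb p 0, orb p 1)))).1
  have he0 : ∀ p : Λ, 0 ≤ (qMap γ Γ (orb p 0, orb p 1) (orb p 0, orb p 1)).re := fun p =>
    (Complex.nonneg_iff.1 (hf.dqg.q_psd.diag_nonneg (i := (orb p 0, orb p 1)))).1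
  have hed : ∑ p : Λ, (qMap γ Γ (orb p 0, orb p 1) (orb p 0, orb p 1)).re
      = ∑ p : Λ, (Γ (orb p 0, orb p 1) (orb p 0, orb p 1)).re := by
    have hc := congrArg Complex.re (sum_holon_eq_sum_doublon γ Γ hf hN)
    rwa [Complex.re_sum, Complex.re_sum] at hc
  have hcsd := Literature.NumberTheory.LFunctions.MauduitRivat.sum_sqrt_le_sqrt_card_mul
    (Finset.univ : Finset Λ) (fun p _ => hd0 p)
  have hcse := Literature.NumberTheory.LFunctions.MauduitRivat.sum_sqrt_le_sqrt_card_mul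
    (Finset.univ : Finset Λ) (fun p _ => he0 p)
  rw [Finset.card_univ, hed] at hcse
  rw [Finset.card_univ] at hcsd
  rw [Real.sqrt_mul (Nat.cast_nonneg _)] at hcsd hcse
  have hsum : ∑ p : Λ, ∑ q : Λ, ‖h p q‖ * ∑ σ : Fin 2, ‖γ (orb p σ) (orb q σ)‖
      ≤ ∑ p : Λ, 2 * ρ * (Real.sqrt (Γ (orb p 0, orb p 1) (orb p 0, orb p 1)).re +
          Real.sqrt (qMap γ Γ (orb p 0, orb p 1) (orb p 0, orb p 1)).re) :=
    Finset.sum_le_sum fun p _ => sum_norm_mul_sum_norm_hop_le hf hN hΛ hrow hdiag p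
  rw [← Finset.mul_sum, Finset.sum_add_distrib] at hsum
  have h0 := StrongCouplingDoublon.re_oneBody_ge_neg h γ
  have hmain : ∑ p : Λ, ∑ q : Λ, ‖h p q‖ * ∑ σ : Fin 2, ‖γ (orb p σ) (orb q σ)‖
      ≤ 4 * ρ * Real.sqrt (Fintype.card Λ) *
        Real.sqrt (∑ p : Λ, (Γ (orb p 0, orb p 1) (orb p 0, orb p 1)).re) := by
    have h2ρ : 0 ≤ 2 * ρ := by linarith
    calc _ ≤ 2 * ρ * (∑ p : Λ, Real.sqrt (Γ (orb p 0, orb p 1) (orb p 0, orb p 1)).re +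
            ∑ p : Λ, Real.sqrt (qMap γ Γ (orb p 0, orb p 1) (orb p 0, orb p 1)).re) := hsum
      _ ≤ 2 * ρ * (Real.sqrt (Fintype.card Λ) *
          Real.sqrt (∑ p : Λ, (Γ (orb p 0, orb p 1) (orb p 0, orb p 1)).re) +
            Real.sqrt (Fintype.card Λ) *
          Real.sqrt (∑ p : Λ, (Γ (orb p 0, orb p 1) (orb p 0, orb p 1)).re)) := by
          gcongr
      _ = _ := by ring
  linarith

/-- **`Re E(γ, Γ) ≥ Re E_core + U·s − 4ρ√|Λ|·√s`** on every feasible pair of the half-filled sector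
programme of a Hubbard-type table with row sums `Σ_q ‖h_pq‖ ≤ ρ` (`h_pp = 0`, on-site `U`).
[folklore] -/
theorem re_rdmEnergy_ge_rowSum (hf : IsDQGFeasibleSector a b γ Γ) (hN : a + b = Fintype.card Λ)
    (hΛ : 2 ≤ Fintype.card Λ) {h : Λ → Λ → ℂ} {ρ : ℝ} (hrow : ∀ p, ∑ q, ‖h p q‖ ≤ ρ)
    (hdiag : ∀ p, h p p = 0) (U : ℝ) {g : Λ → Λ → Λ → Λ → ℂ}
    (hg : ∀ p q r s, g p q r s = if p = q ∧ q = r ∧ r = s then (U : ℂ) else 0) (hnuc : ℂ) :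
    hnuc.re + U * ∑ p : Λ, (Γ (orb p 0, orb p 1) (orb p 0, orb p 1)).re -
        4 * ρ * Real.sqrt (Fintype.card Λ) *
          Real.sqrt (∑ p : Λ, (Γ (orb p 0, orb p 1) (orb p 0, orb p 1)).re)
      ≤ (rdmEnergy h g hnuc γ Γ).re := by
  have hone := re_oneBody_ge_rowSum hf hN hΛ hrow hdiag
  have htwo := StrongCouplingDoublon.interaction_eq hf.dqg.swap_fst hf.dqg.swap_snd (U : ℂ) hg
  have hre : (∑ p : Λ, Γ (orb p 0, orb p 1) (orb p 0, orb p 1)).re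
      = ∑ p : Λ, (Γ (orb p 0, orb p 1) (orb p 0, orb p 1)).re := Complex.re_sum _ _
  rw [rdmEnergy, Complex.add_re, Complex.add_re, htwo, Complex.re_ofReal_mul, hre]
  linarith

/-- **THE EXTENSIVE DOUBLON BUDGET**: under the same hypotheses with `U > 0` and
`Re E(γ, Γ) ≤ Re E_core`, `s ≤ (4ρ√|Λ|/U)² = 16ρ²|Λ|/U²`. [folklore] -/
theorem sum_doublon_le_sq_rowSum (hf : IsDQGFeasibleSector a b γ Γ) (hN : a + b = Fintype.card Λ)
    (hΛ : 2 ≤ Fintype.card Λ) {h : Λ → Λ → ℂ} {ρ : ℝ} (hrow : ∀ p, ∑ q, ‖h p q‖ ≤ ρ)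
    (hdiag : ∀ p, h p p = 0) {U : ℝ} (hU : 0 < U) {g : Λ → Λ → Λ → Λ → ℂ}
    (hg : ∀ p q r s, g p q r s = if p = q ∧ q = r ∧ r = s then (U : ℂ) else 0) {hnuc : ℂ}
    (hE : (rdmEnergy h g hnuc γ Γ).re ≤ hnuc.re) :
    ∑ p : Λ, (Γ (orb p 0, orb p 1) (orb p 0, orb p 1)).re ≤
      (4 * ρ * Real.sqrt (Fintype.card Λ) / U) ^ 2 := by
  have hs0 : 0 ≤ ∑ p : Λ, (Γ (orb p 0, orb p 1) (orb p 0, orb p 1)).re :=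
    sum_nonneg fun p _ =>
      (Complex.nonneg_iff.1 (hf.dqg.d_psd.diag_nonneg (i := (orb p 0, orb p 1)))).1
  have hb := re_rdmEnergy_ge_rowSum hf hN hΛ hrow hdiag U hg hnuc
  exact ClaimN.le_sq_div_of_mul_le_sqrt hs0 hU (by linarith)

/-- **THE EXTENSIVE VALUE FLOOR**: `Re E_core − (4ρ√|Λ|)²/(4U) ≤ E_PQG(a, b)` for every half-filled
Hubbard-type table with row sums `≤ ρ` and `U > 0` (i.e. `E_PQG ≥ Re E_core − 4ρ²|Λ|/U`).
[folklore] -/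
theorem sub_le_pqgSectorEnergy_rowSum (hN : a + b = Fintype.card Λ) (hΛ : 2 ≤ Fintype.card Λ)
    {h : Λ → Λ → ℂ} {ρ : ℝ} (hrow : ∀ p, ∑ q, ‖h p q‖ ≤ ρ) (hdiag : ∀ p, h p p = 0) {U : ℝ}
    (hU : 0 < U) {g : Λ → Λ → Λ → Λ → ℂ}
    (hg : ∀ p q r s, g p q r s = if p = q ∧ q = r ∧ r = s then (U : ℂ) else 0) (hnuc : ℂ) :
    hnuc.re - (4 * ρ * Real.sqrt (Fintype.card Λ)) ^ 2 / (4 * U) ≤ pqgSectorEnergy h g hnuc a b := by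
  refine (le_pqgSectorEnergy_iff h g hnuc (by omega) (by omega)).2 fun γ Γ hf => ?_
  have hb := re_rdmEnergy_ge_rowSum hf hN hΛ hrow hdiag U hg hnuc
  have hs0 : 0 ≤ ∑ p : Λ, (Γ (orb p 0, orb p 1) (orb p 0, orb p 1)).re :=
    sum_nonneg fun p _ =>
      (Complex.nonneg_iff.1 (hf.dqg.d_psd.diag_nonneg (i := (orb p 0, orb p 1)))).1
  have hsq := neg_sq_div_le (C := 4 * ρ * Real.sqrt (Fintype.card Λ)) hU hs0
  linarith

end RowSum

/-! ### §2 The TV-H ring: two neighbours per site, `ρ = 2|t|` -/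

section TVH

open Summit.Ventures.CertifiedQuantumChemistry.Hamiltonians

/-- **Every site of the `L`-ring has at most two neighbours**: `#{q | ringAdj L p q} ≤ 2` (the
neighbours are `p + 1` and `p − 1 (mod L)`). [folklore] -/
theorem card_filter_ringAdj_le_two {L : ℕ} (p : Fin L) :
    (Finset.univ.filter fun q : Fin L => Hamiltonians.ringAdj L p q).card ≤ 2 := by
  calc (Finset.univ.filter fun q : Fin L => Hamiltonians.ringAdj L p q).card
      ≤ ({((p : ℕ) + 1) % L, ((p : ℕ) + (L - 1)) % L} : Finset ℕ).card := by
        refine Finset.card_le_card_of_injOn (fun q : Fin L => (q : ℕ)) ?_ ?_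
        · intro q hq
          rw [Finset.mem_coe, Finset.mem_filter] at hq
          obtain ⟨-, -, h⟩ := hq
          rw [Finset.coe_insert, Finset.coe_singleton, Set.mem_insert_iff, Set.mem_singleton_iff]
          rcases h with h | h
          · exact Or.inl h.symm
          · exact Or.inr (ThermodynamicLimit.eq_mod_of_succ_mod_eq p.isLt q.isLt h)
        · intro q _ q' _ h
          exact Fin.ext h
    _ ≤ 2 := Finset.card_le_two

/-- **The TV-H hopping table has row sums `≤ 2|t|`**: `Σ_q ‖h_pq‖ ≤ 2|t|`. [folklore] -/
theorem sum_norm_hubbardRingTV_h_le (L : ℕ) (t U : ℚ) (p : Fin L) :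
    ∑ q : Fin L, ‖((hubbardRingTV L t U).h p q : ℂ)‖ ≤ 2 * |(t : ℝ)| := by
  have hq : ∀ q : Fin L, ‖((hubbardRingTV L t U).h p q : ℂ)‖ =
      if Hamiltonians.ringAdj L p q then |(t : ℝ)| else 0 := by
    intro q
    simp only [hubbardRingTV]
    split_ifs
    · rw [Rat.cast_neg, norm_neg, ← Complex.ofReal_ratCast, Complex.norm_real, Real.norm_eq_abs]
    · simp
  simp_rw [hq]
  rw [← Finset.sum_filter, Finset.sum_const, nsmul_eq_mul]
  have hc := card_filter_ringAdj_le_two p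
  have ht : 0 ≤ |(t : ℝ)| := abs_nonneg _
  calc ((Finset.univ.filter fun q : Fin L => Hamiltonians.ringAdj L p q).card : ℝ) * |(t : ℝ)|
      ≤ 2 * |(t : ℝ)| := by
        refine mul_le_mul_of_nonneg_right ?_ ht
        exact_mod_cast hc

/-- **THE EXTENSIVE BUDGET ON THE TV-H FILES.** At half filling `a + b = L ≥ 2`, `U > 0`, every feasible
pair of the sector programme of `hubbardRingTV L t U` with `Re E ≤ 0` has
`s ≤ (8|t|√L/U)² = 64t²L/U²` (gen 35's bound had `16t²L³/U²`). [folklore] -/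
theorem hubbardRingTV_sum_doublon_le_linear {L : ℕ} (hL : 2 ≤ L) (t : ℚ) {U : ℚ} (hU : 0 < U)
    {a b : ℕ} (hN : a + b = L) {γ : Matrix (Orb (Fin L)) (Orb (Fin L)) ℂ}
    {Γ : Matrix (Orb (Fin L) × Orb (Fin L)) (Orb (Fin L) × Orb (Fin L)) ℂ}
    (hf : IsDQGFeasibleSector a b γ Γ)
    (hE : (rdmEnergy (fun p q => ((hubbardRingTV L t U).h p q : ℂ))
          (fun p q r s => ((hubbardRingTV L t U).eri p q r s : ℂ))
          ((hubbardRingTV L t U).ecore : ℂ) γ Γ).re ≤ 0) :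
    ∑ p : Fin L, (Γ (orb p 0, orb p 1) (orb p 0, orb p 1)).re ≤
      (8 * |(t : ℝ)| * Real.sqrt L / U) ^ 2 := by
  have hcard : a + b = Fintype.card (Fin L) := by rw [Fintype.card_fin]; exact hN
  have hΛ : 2 ≤ Fintype.card (Fin L) := by rw [Fintype.card_fin]; exact hL
  have hcore : (((hubbardRingTV L t U).ecore : ℚ) : ℂ).re = 0 := by simp [hubbardRingTV]
  have hU' : (0 : ℝ) < (U : ℝ) := by exact_mod_cast hU
  have hb := sum_doublon_le_sq_rowSum hf hcard hΛ (sum_norm_hubbardRingTV_h_le L t U)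
    (StrongCouplingDoublon.hubbardRingTV_h_diag L t U) hU' (StrongCouplingDoublon.hubbardRingTV_eri L t U)
    (hnuc := ((hubbardRingTV L t U).ecore : ℂ)) (by rw [hcore]; exact hE)
  rw [Fintype.card_fin] at hb
  calc _ ≤ (4 * (2 * |(t : ℝ)|) * Real.sqrt L / U) ^ 2 := hb
    _ = (8 * |(t : ℝ)| * Real.sqrt L / U) ^ 2 := by ring

/-- **AT THE OPTIMUM, UNCONDITIONALLY**: for `L ≥ 2`, `U > 0`, at half filling an optimal pair of the
sector programme of `hubbardRingTV L t U` exists and has `s ≤ (8|t|√L/U)²`. [folklore] -/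
theorem hubbardRingTV_optimal_sum_doublon_le_linear {L : ℕ} (hL : 2 ≤ L) (t : ℚ) {U : ℚ}
    (hU : 0 < U) {a b : ℕ} (hN : a + b = L) :
    ∃ (γ : Matrix (Orb (Fin L)) (Orb (Fin L)) ℂ)
      (Γ : Matrix (Orb (Fin L) × Orb (Fin L)) (Orb (Fin L) × Orb (Fin L)) ℂ),
      IsDQGFeasibleSector a b γ Γ ∧
      (rdmEnergy (fun p q => ((hubbardRingTV L t U).h p q : ℂ))
          (fun p q r s => ((hubbardRingTV L t U).eri p q r s : ℂ))
          ((hubbardRingTV L t U).ecore : ℂ) γ Γ).re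
        = pqgSectorEnergy (fun p q => ((hubbardRingTV L t U).h p q : ℂ))
          (fun p q r s => ((hubbardRingTV L t U).eri p q r s : ℂ))
          ((hubbardRingTV L t U).ecore : ℂ) a b ∧
      ∑ p : Fin L, (Γ (orb p 0, orb p 1) (orb p 0, orb p 1)).re ≤
        (8 * |(t : ℝ)| * Real.sqrt L / U) ^ 2 := by
  have ha : a ≤ Fintype.card (Fin L) := by rw [Fintype.card_fin]; omega
  have hb : b ≤ Fintype.card (Fin L) := by rw [Fintype.card_fin]; omega
  obtain ⟨γ, Γ, hf, hE⟩ := exists_isDQGFeasibleSector_rdmEnergy_eq_pqgSectorEnergy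
    (fun p q => ((hubbardRingTV L t U).h p q : ℂ))
    (fun p q r s => ((hubbardRingTV L t U).eri p q r s : ℂ)) ((hubbardRingTV L t U).ecore : ℂ)
    ha hb
  exact ⟨γ, Γ, hf, hE, hubbardRingTV_sum_doublon_le_linear hL t hU hN hf
    (by rw [hE]; exact StrongCouplingDoublon.hubbardRingTV_pqgSectorEnergy_le_zero t U hN)⟩

/-- **THE EXTENSIVE VALUE FLOOR ON THE TV-H FILES**: `−16t²L/U ≤ E_PQG^sector(a, b)` on
`hubbardRingTV L t U` at half filling `a + b = L ≥ 2`, `U > 0` (`(8|t|√L)²/(4U) = 16t²L/U`).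
[folklore] -/
theorem hubbardRingTV_pqgSectorEnergy_ge_linear {L : ℕ} (hL : 2 ≤ L) (t : ℚ) {U : ℚ} (hU : 0 < U)
    {a b : ℕ} (hN : a + b = L) :
    -(16 * (t : ℝ) ^ 2 * (L : ℝ) / U) ≤
      pqgSectorEnergy (fun p q => ((hubbardRingTV L t U).h p q : ℂ))
        (fun p q r s => ((hubbardRingTV L t U).eri p q r s : ℂ))
        ((hubbardRingTV L t U).ecore : ℂ) a b := by
  have hcard : a + b = Fintype.card (Fin L) := by rw [Fintype.card_fin]; exact hN
  have hΛ : 2 ≤ Fintype.card (Fin L) := by rw [Fintype.card_fin]; exact hL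
  have hU' : (0 : ℝ) < (U : ℝ) := by exact_mod_cast hU
  have hb := sub_le_pqgSectorEnergy_rowSum hcard hΛ (sum_norm_hubbardRingTV_h_le L t U)
    (StrongCouplingDoublon.hubbardRingTV_h_diag L t U) hU' (StrongCouplingDoublon.hubbardRingTV_eri L t U)
    ((hubbardRingTV L t U).ecore : ℂ)
  have hcore : (((hubbardRingTV L t U).ecore : ℚ) : ℂ).re = 0 := by simp [hubbardRingTV]
  have hL' : Real.sqrt (L : ℝ) ^ 2 = L := Real.sq_sqrt (Nat.cast_nonneg _)
  have hconst : (4 * (2 * |(t : ℝ)|) * Real.sqrt (Fintype.card (Fin L))) ^ 2 / (4 * U)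
      = 16 * (t : ℝ) ^ 2 * (L : ℝ) / U := by
    rw [Fintype.card_fin, mul_pow, mul_pow, hL', mul_pow, sq_abs]
    field_simp
    ring
  rw [hcore, hconst, zero_sub] at hb
  exact hb

end TVH

/-! ### §3 The conjecture leaf's scaled gap is at most `4` per site -/

section Leaf

open Summit.Ventures.CertifiedQuantumChemistry.Hamiltonians

/-- **`ĉ_DQG(2n;U) ≤ 8n`** in the leaf's spelling (`n ≥ 1`, `U > 0`): `E₀(n, n) ≤ 0` at half filling and
`E_PQG^sector ≥ −16·(2n)/U` (`t = 1`), so `(U/4)·(E₀ − E_PQG) ≤ 4·(2n) = 8n` — at most `4` per site.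
[folklore] -/
theorem scaledGap_sector_le_linear {n : ℕ} (hn : 1 ≤ n) {U : ℚ} (hU : 0 < U) :
    ((U : ℝ) / 4) * (Model.energy (hubbardRingTV (2 * n) 1 U) n n -
        Model.pqgSectorEnergy (hubbardRingTV (2 * n) 1 U) n n) ≤ 8 * n := by
  have hU' : (0 : ℝ) < (U : ℝ) := by exact_mod_cast hU
  have hE : Model.energy (hubbardRingTV (2 * n) 1 U) n n ≤ 0 :=
    StrongCouplingDoublon.hubbardRingTV_sectorGroundEnergy_le_zero 1 U (by omega : n + n = 2 * n)
  have hP : -(16 * ((1 : ℚ) : ℝ) ^ 2 * ((2 * n : ℕ) : ℝ) / U) ≤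
      Model.pqgSectorEnergy (hubbardRingTV (2 * n) 1 U) n n :=
    hubbardRingTV_pqgSectorEnergy_ge_linear (by omega) 1 hU (by omega : n + n = 2 * n)
  simp only [Rat.cast_one, one_pow, mul_one, Nat.cast_mul, Nat.cast_ofNat] at hP
  calc ((U : ℝ) / 4) * (Model.energy (hubbardRingTV (2 * n) 1 U) n n -
        Model.pqgSectorEnergy (hubbardRingTV (2 * n) 1 U) n n)
      ≤ ((U : ℝ) / 4) * (16 * (2 * (n : ℝ)) / U) :=
        mul_le_mul_of_nonneg_left (by linarith) (by positivity)
    _ = 8 * n := by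
        field_simp
        ring

/-- **`ĉ_DQG+S²(2n;U) ≤ 8n`** in the leaf's spelling (`n ≥ 1`, `U > 0`): the singlet-restricted value
is above the sector value. [folklore] -/
theorem scaledGap_singlet_le_linear {n : ℕ} (hn : 1 ≤ n) {U : ℚ} (hU : 0 < U) :
    ((U : ℝ) / 4) * (Model.energy (hubbardRingTV (2 * n) 1 U) n n -
        Model.pqgSingletEnergy (hubbardRingTV (2 * n) 1 U) n) ≤ 8 * n := by
  have hU' : (0 : ℝ) < (U : ℝ) := by exact_mod_cast hU
  have hnk : n ≤ Fintype.card (Fin (2 * n)) := by rw [Fintype.card_fin]; omega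
  have h3 : Model.pqgSectorEnergy (hubbardRingTV (2 * n) 1 U) n n ≤
      Model.pqgSingletEnergy (hubbardRingTV (2 * n) 1 U) n :=
    pqgSectorEnergy_le_pqgSingletEnergy _ _ _ hnk
  refine le_trans ?_ (scaledGap_sector_le_linear hn hU)
  exact mul_le_mul_of_nonneg_left (by linarith) (by positivity)

/-- **ANY LIMIT OF `ĉ_DQG(2n;·)` IS AT MOST `8n`** (`n ≥ 1`): if the scaled gap converges along
`U → ∞` to `c`, then `0 ≤ c ≤ 8n` — IF the constant `c n` of `ConjectureSU2_DQG` exists, its per-site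
value `c n / (2n)` is at most `4`. [folklore] -/
theorem scaledGap_sector_limit_le_linear {n : ℕ} (hn : 1 ≤ n) {c : ℝ}
    (hc : Filter.Tendsto (fun U : ℚ => ((U : ℝ) / 4) *
        (Model.energy (hubbardRingTV (2 * n) 1 U) n n -
          Model.pqgSectorEnergy (hubbardRingTV (2 * n) 1 U) n n)) Filter.atTop (nhds c)) :
    c ∈ Set.Icc (0 : ℝ) (8 * n) :=
  isClosed_Icc.mem_of_tendsto hc (Filter.eventually_atTop.2 ⟨1, fun _ hU =>
    ⟨(scaledGap_sector_mem_Icc hn (lt_of_lt_of_le one_pos hU)).1,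
      scaledGap_sector_le_linear hn (lt_of_lt_of_le one_pos hU)⟩⟩)

/-- **ANY LIMIT OF `ĉ_DQG+S²(2n;·)` IS AT MOST `8n`** (`n ≥ 1`) — the per-site value of the constant of
`ConjectureSU2_DQGS2`, if it exists, is at most `4`. [folklore] -/
theorem scaledGap_singlet_limit_le_linear {n : ℕ} (hn : 1 ≤ n) {c : ℝ}
    (hc : Filter.Tendsto (fun U : ℚ => ((U : ℝ) / 4) *
        (Model.energy (hubbardRingTV (2 * n) 1 U) n n -
          Model.pqgSingletEnergy (hubbardRingTV (2 * n) 1 U) n)) Filter.atTop (nhds c)) :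
    c ∈ Set.Icc (0 : ℝ) (8 * n) :=
  isClosed_Icc.mem_of_tendsto hc (Filter.eventually_atTop.2 ⟨1, fun _ hU =>
    ⟨(scaledGap_singlet_mem_Icc hn (lt_of_lt_of_le one_pos hU)).1,
      scaledGap_singlet_le_linear hn (lt_of_lt_of_le one_pos hU)⟩⟩)

end Leaf

end StrongCouplingGap

end Summit.Ventures.CertifiedQuantumChemistry
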